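import Mathlib
import Summits.Ventures.PercRepro2.Defs
import Summits.Ventures.PercRepro2.Independence
import Summits.Ventures.PercRepro2.Harris
import Summits.Ventures.PercRepro2.Graph
import Summits.Ventures.PercRepro2.Exploration
import Summits.Ventures.PercRepro2.Events
import Summits.Ventures.PercRepro2.Statements
import Summits.Ventures.PercRepro2.FourFunctions
import Summits.Ventures.PercRepro2.Induced
import Summits.Ventures.PercRepro2.Frontier
import Summits.Ventures.PercRepro2.ObsIndependence
import Summits.Ventures.PercRepro2.BHK
import Summits.Ventures.PercRepro2.BHKEvents
import Summits.Ventures.PercRepro2.ClusterProperty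
import Summits.Ventures.PercRepro2.BHKPair
import Summits.Ventures.PercRepro2.CondAvoidPA
import Summits.Ventures.PercRepro2.CondAvoidZPA
import Summits.Ventures.PercRepro2.BoxUnionDefs
import Summits.Ventures.PercRepro2.BoxUnion
import Summits.Ventures.PercRepro2.BoxUnionPair
import Summits.Ventures.PercRepro2.PairTP2
import Summits.Ventures.PercRepro2.PairTP2Main
import Summits.Ventures.PercRepro2.UnionRowMech
import Summits.Ventures.PercRepro2.UnionRowMech2
import Summits.Ventures.PercRepro2.UnionRowMech3
import Summits.Ventures.PercRepro2.UnionRowMech4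
import Summits.Ventures.PercRepro2.UnionRowMech5
import Summits.Ventures.PercRepro2.UnionRowGrid
import Summits.Ventures.PercRepro2.UnionRowGrid2
import Summits.Ventures.PercRepro2.UnionRowGrid3
import Summits.Ventures.PercRepro2.UnionRowCellDefs
import Summits.Ventures.PercRepro2.UnionRowCell
import Summits.Ventures.PercRepro2.UnionRowBilinear
import Summits.Ventures.PercRepro2.UnionRowGeneral

/-!
# The two-status union row of row 2′CON-U on every graph, for every union type
(blind cell PercRepro2, mine-1 g40; proofs/MINE1-UNIONROW2.md §8)

`UnionRowCell.union_row_nonneg` (up-set observables) and `UnionRowCell.union_row_nonneg_general`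
(all (Z)-increasing observables) proved the two-status union row in the cell's own form on every
graph for every `X, Y ⊆ {u, v}` — except when both double-hit cells are cut by the union event
(`X = Y = {u, v}`) and the up-sets fall in a residual pattern. With
`UnionRowGrid3.double_exclusion_row_all` that exception is gone:

**THEOREM** (`union_row_nonneg_general_full`): for `u ≠ v`, every admissible weight vector with
`P(s ↮ t) > 0`, ALL `X, Y ⊆ {u, v}` and all `f, g` increasing in `C_s` and decreasing in `C_t`,
`E[(f(σ) − E[f(σ) | Q]) (g(σ) − E[g(σ) | Q]) · 1_{Q ∩ ({s ↮ X} ∪ {t ↮ Y})}] ≥ 0` —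
`PairTP2.hit_boxUnion_nonneg_of_pairTP2` with its (PAIR-TP2) hypothesis dropped, on every
finite graph. `union_row_nonneg_full` is the up-set-observable form.
-/

namespace Summit.Ventures.PercRepro2

namespace UnionRowCell

open Finset UnionRowMech UnionRowGrid
open scoped Classical

variable {V : Type*} {E : Type*} [Fintype V] [DecidableEq V] [Fintype E] [DecidableEq E]
variable (ends : E → Sym2 V) (s t u v : V) {p : E → ℝ}

/-- The sum of the terms over the union cells is nonnegative, for every `X, Y`. -/
lemma sum_term_unionCells_nonneg_all (hp : IsProbVec p) (X Y : Finset V) {A B : Finset Grid}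
    (hA : IsUp A) (hB : IsUp B) :
    0 ≤ ∑ k ∈ unionCells u v X Y, term (gridMass ends s t u v p) A B k := by
  rw [sum_term_unionCells, sum_term_univ]
  have hZ := total_nonneg (gridMass_nonneg ends s t u v hp)
  have hM0 := gridMass_nonneg ends s t u v hp
  by_cases h1 : UnionRowMech.ST ∈ unionCells u v X Y <;>
    by_cases h2 : TS ∈ unionCells u v X Y
  · rw [if_pos h1, if_pos h2, sub_zero, sub_zero]
    have := pa_Q ends s t u v hp A B hA hB
    exact mul_nonneg hZ (by nlinarith)
  · rw [if_pos h1, if_neg h2, sub_zero]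
    have := single_exclusion_generic hM0 (fun A hA h => up_subset_Ru hA h)
      (fun A hA h => down_subset_Rv' hA h) TS_notMem_Ru TS_notMem_Rv'
      (fun A B hA hB => pa_Q ends s t u v hp A B hA hB)
      (fun A B hA hB hAR hBR => pa_Ru ends s t u v hp A B hA hB hAR hBR)
      (fun A B hA hB hAR hBR => pa_Rv' ends s t u v hp A B hA hB hAR hBR) hA hB
    unfold term
    exact this
  · rw [if_neg h1, if_pos h2, sub_zero]
    have := single_exclusion_row ends s t u v hp hA hB
    unfold term
    exact this
  · rw [if_neg h1, if_neg h2]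
    have := double_exclusion_row_all ends s t u v hp hA hB
    unfold term
    exact this

/-- **The two-status union row in the cell's own form, on every graph, for every union type**:
`union_row_nonneg` without its residual hypothesis. -/
theorem union_row_nonneg_full (hne : u ≠ v) (hp : IsProbVec p)
    (hQ : 0 < prob p (connEvent ends s t)ᶜ) {X Y : Finset V} (hX : X ⊆ {u, v})
    (hY : Y ⊆ {u, v}) {A B : Finset Grid} (hA : IsUp A) (hB : IsUp B) :
    0 ≤ expect p (((connEvent ends s t)ᶜ ∩ ((hitEvent ends s X)ᶜ ∪ (hitEvent ends t Y)ᶜ)).indicator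
      (fun ω =>
        (obs u v A (BoxUnionPair.status ends {u, v} s t ω).1
              (OrderDual.ofDual (BoxUnionPair.status ends {u, v} s t ω).2) -
            BoxUnionPair.condMean p ends {u, v} s t
              (fun k => obs u v A k.1 (OrderDual.ofDual k.2))) *
          (obs u v B (BoxUnionPair.status ends {u, v} s t ω).1
              (OrderDual.ofDual (BoxUnionPair.status ends {u, v} s t ω).2) -
            BoxUnionPair.condMean p ends {u, v} s t
              (fun k => obs u v B k.1 (OrderDual.ofDual k.2))))) := by
  rw [row_eq_gridRow ends s t u v hne A B hX hY]
  have hZ : 0 < total (gridMass ends s t u v p) := by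
    rw [total_gridMass_eq]
    exact hQ
  rw [gridRow_eq _ _ A B hZ.ne']
  exact div_nonneg (sum_term_unionCells_nonneg_all ends s t u v hp X Y hA hB) (sq_nonneg _)

/-- **The two-status union row for all (Z)-increasing observables, on every graph, for every
union type**: for `u ≠ v`, every admissible weight vector with `P(s ↮ t) > 0`, all
`X, Y ⊆ {u, v}`, and all `f, g` increasing in `C_s` and decreasing in `C_t`,
`E[(f(σ) − E[f(σ) | Q]) (g(σ) − E[g(σ) | Q]) · 1_{Q ∩ ({s ↮ X} ∪ {t ↮ Y})}] ≥ 0` —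
`union_row_nonneg_general` without its double-hit-cell hypothesis. -/
theorem union_row_nonneg_general_full (hne : u ≠ v) (hp : IsProbVec p)
    (hQ : 0 < prob p (connEvent ends s t)ᶜ) {X Y : Finset V} (hX : X ⊆ {u, v})
    (hY : Y ⊆ {u, v}) {f g : Finset V → Finset V → ℝ}
    (hf : ∀ ⦃W W' C C' : Finset V⦄, W ⊆ W' → C' ⊆ C → f W C ≤ f W' C')
    (hg : ∀ ⦃W W' C C' : Finset V⦄, W ⊆ W' → C' ⊆ C → g W C ≤ g W' C') :
    0 ≤ expect p (((connEvent ends s t)ᶜ ∩ ((hitEvent ends s X)ᶜ ∪ (hitEvent ends t Y)ᶜ)).indicator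
      (fun ω =>
        (f (BoxUnionPair.status ends {u, v} s t ω).1
              (OrderDual.ofDual (BoxUnionPair.status ends {u, v} s t ω).2) -
            BoxUnionPair.condMean p ends {u, v} s t
              (fun k => f k.1 (OrderDual.ofDual k.2))) *
          (g (BoxUnionPair.status ends {u, v} s t ω).1
              (OrderDual.ofDual (BoxUnionPair.status ends {u, v} s t ω).2) -
            BoxUnionPair.condMean p ends {u, v} s t
              (fun k => g k.1 (OrderDual.ofDual k.2))))) := by
  have hZ : total (gridMass ends s t u v p) ≠ 0 := by
    rw [total_gridMass_eq]
    exact hQ.ne'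
  rw [row_eq_rowVal ends s t u v hne f g hX hY hZ]
  refine div_nonneg ?_ (sq_nonneg _)
  refine rowVal_nonneg_of_upsets _ _ (fun A B hA hB => ?_) _ _ (gridFun_mono u v hf)
    (gridFun_mono u v hg)
  rw [rowVal_ind_eq]
  exact sum_term_unionCells_nonneg_all ends s t u v hp X Y hA hB

end UnionRowCell

end Summit.Ventures.PercRepro2
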